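import Mathlib.Tactic
import HarnessLib
import HarnessLib.Audit.Tags
import Summits.CriticalPhenomena.PercolationContinuityZ3.Theorems.PercNearOneGluingNoHeavyLowerTailSahiAntichainSplitSeven

/-!
# Antichains, meets plus joins: a `2 + 3` split with a (co)sunflower three-side creates three new labels

Support file (seat `prim-masterthm-p1`, gen 36; `--supports stmt-CriticalPhenomena-4575`).  No `sorry`, no new definitions, standard
axioms.  Memo `run/shared/lean/prim/prim-masterthm/FROM-prim-masterthm-p1-g36-DUALITY-PROJECTION-SUNFLOWER.md` §7.

SETTING (files `…SahiAntichainSplit*`): `newLabels P r` counts the cross labels created by the split at `r`.  V5 for eight members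
needs «five members ⟹ nine labels», whose `2 + 3` splits need three new labels when the three-side is a (co)sunflower (otherwise the
three-side alone has five labels and the two-member step gives two more).

NEW HERE ([this work], gen 36): `three_le_newLabels_of_two_sunflower_three` — `#above P r = 2` and `below P r` a three-petal
SUNFLOWER ⟹ `newLabels P r ≥ 3`.  [If a member above meets every member below in the core only, its three cross joins are pairwise
distinct; if both members above do, the other member's joins differ from these as well (a point of `a \ a'` would lie in the core),
giving three new joins; otherwise some cross meet is new, and with at most one new join a row has two equal joins, which puts two petals
inside that member and yields two new meets.]  By complement duality: `three_le_newLabels_of_cosunflower_three_two`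
(`above` a three-member CO-sunflower, `#below = 2`).  The mirror cases (`above` a sunflower with `#below = 2`, and its dual) are the
remaining ingredient for «five members ⟹ nine labels» (memo §6/§7).
HONEST FRAMING: V5 in general remains OPEN. [this work]
-/

namespace Summit.CriticalPhenomena.PercolationContinuityZ3.Theorems.SahiColouredDaykin

open Finset

variable {α : Type*} [DecidableEq α]

/-- **`2 + 3`, sunflower below.** [this work] -/
theorem three_le_newLabels_of_two_sunflower_three {P : Finset (Finset α)} {r : α} {K : Finset α}
    (hanti : IsAntichain (· ⊆ ·) (P : Set (Finset α))) (h2 : #(above P r) = 2) (h3 : #(below P r) = 3)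
    (hK : ∀ b ∈ below P r, ∀ b' ∈ below P r, b ≠ b' → b ∩ b' = K) : 3 ≤ newLabels P r := by
  obtain ⟨a, a', haa, hAeq⟩ := card_eq_two.1 h2
  obtain ⟨b₁, b₂, b₃, h12, h13, h23, hBeq⟩ := card_eq_three.1 h3
  have ha : a ∈ above P r := by rw [hAeq]; simp
  have ha' : a' ∈ above P r := by rw [hAeq]; simp
  have hb₁ : b₁ ∈ below P r := by rw [hBeq]; simp
  have hb₂ : b₂ ∈ below P r := by rw [hBeq]; simp
  have hb₃ : b₃ ∈ below P r := by rw [hBeq]; simp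
  obtain ⟨haP, _⟩ := mem_above_iff.1 ha
  obtain ⟨ha'P, _⟩ := mem_above_iff.1 ha'
  have hJ : joins (above P r) = {a ∪ a'} := by rw [hAeq, joins_pair haa]
  have nJ : ∀ {x y : Finset α}, x ∈ above P r → y ∈ below P r → x ∪ y ≠ a ∪ a' → x ∪ y ∈ newJoins P r := by
    intro x y hx hy hne; rw [union_mem_newJoins_iff hx hy, hJ, mem_singleton]; exact hne
  have nM : ∀ {x y : Finset α}, x ∈ above P r → y ∈ below P r → x ∩ y ≠ K → x ∩ y ∈ newMeets P r := by
    intro x y hx hy hne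
    rw [inter_mem_newMeets_iff hx hy]
    intro h
    obtain ⟨e, he, e', he', hee', heq⟩ := mem_meets_iff.1 h
    exact hne (heq.trans (hK e he e' he' hee'))
  -- core and petals
  have hKsub : ∀ {b : Finset α}, b ∈ below P r → K ⊆ b := by
    intro b hb
    by_cases h : b = b₁
    · subst h; rw [← hK b hb b₂ hb₂ h12]; exact inter_subset_left
    · rw [← hK b hb b₁ hb₁ h]; exact inter_subset_left
  have hpet : ∀ {b b' : Finset α}, b ∈ below P r → b' ∈ below P r → b ≠ b' → ∃ t ∈ b, t ∉ K ∧ t ∉ b' := by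
    intro b b' hb hb' hne
    obtain ⟨hbP, _⟩ := mem_below_iff.1 hb
    obtain ⟨hb'P, _⟩ := mem_below_iff.1 hb'
    obtain ⟨t, htb, htb'⟩ := not_subset.1 (hanti (mem_coe.2 hbP) (mem_coe.2 hb'P) hne)
    exact ⟨t, htb, fun htK => htb' (hKsub hb' htK), htb'⟩
  -- one row, two equal joins: two distinct new meets
  have key : ∀ {x b b' : Finset α}, x ∈ above P r → b ∈ below P r → b' ∈ below P r → b ≠ b' → x ∪ b = x ∪ b' →
      x ∩ b ∈ newMeets P r ∧ x ∩ b' ∈ newMeets P r ∧ x ∩ b ≠ x ∩ b' := by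
    intro x b b' hx hb hb' hne hu
    obtain ⟨w, hwb, hwK, hwb'⟩ := hpet hb hb' hne
    obtain ⟨w', hw'b', hw'K, hw'b⟩ := hpet hb' hb hne.symm
    have hwx : w ∈ x := mem_of_union_eq hu hwb hwb'
    have hw'x : w' ∈ x := mem_of_union_eq hu.symm hw'b' hw'b
    refine ⟨nM hx hb (fun h => hwK (h ▸ mem_inter.2 ⟨hwx, hwb⟩)), nM hx hb' (fun h => hw'K (h ▸ mem_inter.2 ⟨hw'x, hw'b'⟩)), ?_⟩
    intro h; have : w ∈ x ∩ b' := h ▸ mem_inter.2 ⟨hwx, hwb⟩; exact hwb' (mem_inter.1 this).2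
  -- a row whose meets are all the core has pairwise distinct joins
  have rowold : ∀ {x : Finset α}, x ∩ b₁ = K → x ∩ b₂ = K → x ∩ b₃ = K →
      x ∪ b₁ ≠ x ∪ b₂ ∧ x ∪ b₁ ≠ x ∪ b₃ ∧ x ∪ b₂ ≠ x ∪ b₃ := by
    intro x e1 e2 e3
    exact ⟨fun h => h12 (eq_of_inter_eq_of_union_eq (e1.trans e2.symm) h),
      fun h => h13 (eq_of_inter_eq_of_union_eq (e1.trans e3.symm) h),
      fun h => h23 (eq_of_inter_eq_of_union_eq (e2.trans e3.symm) h)⟩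
  -- counting
  have cnt21 : ∀ {Z₁ Z₂ W : Finset α}, Z₁ ∈ newMeets P r → Z₂ ∈ newMeets P r → Z₁ ≠ Z₂ → W ∈ newJoins P r → 3 ≤ newLabels P r := by
    intro Z₁ Z₂ W h1 h2' h12' hW
    have := card_add_card_le_newLabels (S := {Z₁, Z₂}) (T := {W})
      (by intro Z hZ; rcases mem_insert.1 hZ with rfl | hZ; exact h1; rw [mem_singleton.1 hZ]; exact h2')
      (by intro V hV; rw [mem_singleton.1 hV]; exact hW)
    rw [card_pair h12', card_singleton] at this; omega
  have cnt12 : ∀ {Z W₁ W₂ : Finset α}, Z ∈ newMeets P r → W₁ ∈ newJoins P r → W₂ ∈ newJoins P r → W₁ ≠ W₂ → 3 ≤ newLabels P r := by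
    intro Z W₁ W₂ hZ h1 h2' h12'
    have := card_add_card_le_newLabels (S := {Z}) (T := {W₁, W₂})
      (by intro V hV; rw [mem_singleton.1 hV]; exact hZ)
      (by intro V hV; rcases mem_insert.1 hV with rfl | hV; exact h1; rw [mem_singleton.1 hV]; exact h2')
    rw [card_pair h12', card_singleton] at this; omega
  have cnt30 : ∀ {Z₁ Z₂ Z₃ : Finset α}, Z₁ ∈ newMeets P r → Z₂ ∈ newMeets P r → Z₃ ∈ newMeets P r →
      Z₁ ≠ Z₂ → Z₁ ≠ Z₃ → Z₂ ≠ Z₃ → 3 ≤ newLabels P r := by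
    intro Z₁ Z₂ Z₃ h1 h2' h3' h12' h13' h23'
    have := card_add_card_le_newLabels (S := {Z₁, Z₂, Z₃}) (T := ∅)
      (by
        intro Z hZ
        rcases mem_insert.1 hZ with rfl | hZ; exact h1
        rcases mem_insert.1 hZ with rfl | hZ; exact h2'
        rw [mem_singleton.1 hZ]; exact h3')
      (empty_subset _)
    rw [card_eq_three.2 ⟨_, _, _, h12', h13', h23', rfl⟩, card_empty] at this; omega
  have cnt03 : ∀ {W₁ W₂ W₃ : Finset α}, W₁ ∈ newJoins P r → W₂ ∈ newJoins P r → W₃ ∈ newJoins P r →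
      W₁ ≠ W₂ → W₁ ≠ W₃ → W₂ ≠ W₃ → 3 ≤ newLabels P r := by
    intro W₁ W₂ W₃ h1 h2' h3' h12' h13' h23'
    have := card_add_card_le_newLabels (S := ∅) (T := {W₁, W₂, W₃}) (empty_subset _)
      (by
        intro W hW
        rcases mem_insert.1 hW with rfl | hW; exact h1
        rcases mem_insert.1 hW with rfl | hW; exact h2'
        rw [mem_singleton.1 hW]; exact h3')
    rw [card_eq_three.2 ⟨_, _, _, h12', h13', h23', rfl⟩, card_empty] at this; omega
  -- three of four pairwise distinct cross joins are new
  have threeOfFour : ∀ {W₁ W₂ W₃ W₄ : Finset α},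
      (W₁ ≠ a ∪ a' → W₁ ∈ newJoins P r) → (W₂ ≠ a ∪ a' → W₂ ∈ newJoins P r) → (W₃ ≠ a ∪ a' → W₃ ∈ newJoins P r) →
      (W₄ ≠ a ∪ a' → W₄ ∈ newJoins P r) → W₁ ≠ W₂ → W₁ ≠ W₃ → W₁ ≠ W₄ → W₂ ≠ W₃ → W₂ ≠ W₄ → W₃ ≠ W₄ → 3 ≤ newLabels P r := by
    intro W₁ W₂ W₃ W₄ h1 h2' h3' h4' h12' h13' h14' h23' h24' h34'
    by_cases e1 : W₁ = a ∪ a'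
    · exact cnt03 (h2' (fun h => h12' (e1.trans h.symm))) (h3' (fun h => h13' (e1.trans h.symm)))
        (h4' (fun h => h14' (e1.trans h.symm))) h23' h24' h34'
    · by_cases e2 : W₂ = a ∪ a'
      · exact cnt03 (h1 e1) (h3' (fun h => h23' (e2.trans h.symm))) (h4' (fun h => h24' (e2.trans h.symm))) h13' h14' h34'
      · by_cases e3 : W₃ = a ∪ a'
        · exact cnt03 (h1 e1) (h2' e2) (h4' (fun h => h34' (e3.trans h.symm))) h12' h14' h24'
        · exact cnt03 (h1 e1) (h2' e2) (h3' e3) h12' h13' h23'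
  -- MAIN.  Case 1: row `a` has all meets equal to the core.
  have rowcase : ∀ {x x' : Finset α}, x ∈ above P r → x' ∈ above P r → x ≠ x' →
      (∀ {y y' : Finset α}, y ∈ above P r → y' ∈ below P r → y ∪ y' ≠ a ∪ a' → y ∪ y' ∈ newJoins P r) →
      x ∩ b₁ = K → x ∩ b₂ = K → x ∩ b₃ = K → 3 ≤ newLabels P r := by
    intro x x' hx hx' hxx' nJ' e1 e2 e3
    obtain ⟨d12, d13, d23⟩ := rowold e1 e2 e3
    by_cases hx'row : x' ∩ b₁ ≠ K ∨ x' ∩ b₂ ≠ K ∨ x' ∩ b₃ ≠ K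
    · -- a new meet in row x', two new joins in row x
      have hZ : ∃ Z, Z ∈ newMeets P r := by
        rcases hx'row with h | h | h
        · exact ⟨_, nM hx' hb₁ h⟩
        · exact ⟨_, nM hx' hb₂ h⟩
        · exact ⟨_, nM hx' hb₃ h⟩
      obtain ⟨Z, hZ⟩ := hZ
      by_cases f1 : x ∪ b₁ = a ∪ a'
      · exact cnt12 hZ (nJ' hx hb₂ (fun h => d12 (f1.trans h.symm))) (nJ' hx hb₃ (fun h => d13 (f1.trans h.symm))) d23
      · by_cases f2 : x ∪ b₂ = a ∪ a'
        · exact cnt12 hZ (nJ' hx hb₁ f1) (nJ' hx hb₃ (fun h => d23 (f2.trans h.symm))) d13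
        · exact cnt12 hZ (nJ' hx hb₁ f1) (nJ' hx hb₂ f2) d12
    · -- both rows all old: four pairwise distinct joins x∪b₁, x∪b₂, x∪b₃, x'∪b₁
      push Not at hx'row
      obtain ⟨f1, f2, f3⟩ := hx'row
      obtain ⟨hxP, _⟩ := mem_above_iff.1 hx
      obtain ⟨hx'P, _⟩ := mem_above_iff.1 hx'
      obtain ⟨t, htx', htx⟩ := not_subset.1 (hanti (mem_coe.2 hx'P) (mem_coe.2 hxP) hxx'.symm)
      have hKx : K ⊆ x := e1 ▸ inter_subset_left
      have cross' : ∀ {b b' : Finset α}, b ∈ below P r → x' ∩ b = K → x ∪ b ≠ x' ∪ b' := by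
        intro b b' hb hm h
        have : t ∈ x ∪ b := by rw [h]; exact mem_union_left _ htx'
        rcases mem_union.1 this with h' | h'
        · exact htx h'
        · exact htx (hKx (hm ▸ mem_inter.2 ⟨htx', h'⟩))
      exact threeOfFour (nJ' hx hb₁) (nJ' hx hb₂) (nJ' hx hb₃) (nJ' hx' hb₁) d12 d13 (cross' hb₁ f1) d23 (cross' hb₂ f2) (cross' hb₃ f3)
  by_cases hrowa : a ∩ b₁ = K ∧ a ∩ b₂ = K ∧ a ∩ b₃ = K
  · exact rowcase ha ha' haa nJ hrowa.1 hrowa.2.1 hrowa.2.2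
  by_cases hrowa' : a' ∩ b₁ = K ∧ a' ∩ b₂ = K ∧ a' ∩ b₃ = K
  · exact rowcase ha' ha haa.symm (fun hy hy' hne => by exact nJ hy hy' hne) hrowa'.1 hrowa'.2.1 hrowa'.2.2
  -- Case 2: each row has a new meet.  If two cross joins in a row coincide we get two new meets in that row plus ...
  have hZa : ∃ i, i ∈ below P r ∧ a ∩ i ∈ newMeets P r := by
    push Not at hrowa
    by_cases e1 : a ∩ b₁ = K
    · by_cases e2 : a ∩ b₂ = K
      · exact ⟨b₃, hb₃, nM ha hb₃ (hrowa e1 e2)⟩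
      · exact ⟨b₂, hb₂, nM ha hb₂ e2⟩
    · exact ⟨b₁, hb₁, nM ha hb₁ e1⟩
  have hZa' : ∃ i, i ∈ below P r ∧ a' ∩ i ∈ newMeets P r := by
    push Not at hrowa'
    by_cases e1 : a' ∩ b₁ = K
    · by_cases e2 : a' ∩ b₂ = K
      · exact ⟨b₃, hb₃, nM ha' hb₃ (hrowa' e1 e2)⟩
      · exact ⟨b₂, hb₂, nM ha' hb₂ e2⟩
    · exact ⟨b₁, hb₁, nM ha' hb₁ e1⟩
  obtain ⟨i, hi, hZi⟩ := hZa
  -- the three joins of row a: if pairwise distinct, two are new (+ the new meet); else `key` gives two new meets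
  by_cases g12 : a ∪ b₁ = a ∪ b₂
  · obtain ⟨n1, n2, n12⟩ := key ha hb₁ hb₂ h12 g12
    -- need one more label: a new join anywhere, or a third new meet
    by_cases hy : ∃ x ∈ above P r, ∃ y ∈ below P r, x ∪ y ≠ a ∪ a'
    · obtain ⟨x, hx, y, hy, hne⟩ := hy
      exact cnt21 n1 n2 n12 (nJ hx hy hne)
    · -- all six cross joins equal u: all petals inside a, so a ∩ b₃ is a third new meet
      push Not at hy
      have g13 : a ∪ b₁ = a ∪ b₃ := (hy a ha b₁ hb₁).trans (hy a ha b₃ hb₃).symm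
      obtain ⟨_, n3, n13⟩ := key ha hb₁ hb₃ h13 g13
      have g23 : a ∪ b₂ = a ∪ b₃ := (hy a ha b₂ hb₂).trans (hy a ha b₃ hb₃).symm
      obtain ⟨_, _, n23⟩ := key ha hb₂ hb₃ h23 g23
      exact cnt30 n1 n2 n3 n12 n13 n23
  by_cases g13 : a ∪ b₁ = a ∪ b₃
  · obtain ⟨n1, n3, n13⟩ := key ha hb₁ hb₃ h13 g13
    by_cases hy : ∃ x ∈ above P r, ∃ y ∈ below P r, x ∪ y ≠ a ∪ a'
    · obtain ⟨x, hx, y, hy, hne⟩ := hy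
      exact cnt21 n1 n3 n13 (nJ hx hy hne)
    · push Not at hy
      exact absurd ((hy a ha b₁ hb₁).trans (hy a ha b₂ hb₂).symm) g12
  by_cases g23 : a ∪ b₂ = a ∪ b₃
  · obtain ⟨n2, n3, n23⟩ := key ha hb₂ hb₃ h23 g23
    by_cases hy : ∃ x ∈ above P r, ∃ y ∈ below P r, x ∪ y ≠ a ∪ a'
    · obtain ⟨x, hx, y, hy, hne⟩ := hy
      exact cnt21 n2 n3 n23 (nJ hx hy hne)
    · push Not at hy
      exact absurd ((hy a ha b₁ hb₁).trans (hy a ha b₂ hb₂).symm) g12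
  -- row a has three pairwise distinct joins: two of them new, plus the new meet of row a
  by_cases f1 : a ∪ b₁ = a ∪ a'
  · exact cnt12 hZi (nJ ha hb₂ (fun h => g12 (f1.trans h.symm))) (nJ ha hb₃ (fun h => g13 (f1.trans h.symm))) g23
  · by_cases f2 : a ∪ b₂ = a ∪ a'
    · exact cnt12 hZi (nJ ha hb₁ f1) (nJ ha hb₃ (fun h => g23 (f2.trans h.symm))) g13
    · exact cnt12 hZi (nJ ha hb₁ f1) (nJ ha hb₂ f2) g12

/-- **`3 + 2`, co-sunflower above**, by complement duality. [this work] -/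
theorem three_le_newLabels_of_cosunflower_three_two {P : Finset (Finset α)} {r : α} {U : Finset α}
    (hanti : IsAntichain (· ⊆ ·) (P : Set (Finset α))) (h3 : #(above P r) = 3) (h2 : #(below P r) = 2)
    (hU : ∀ a ∈ above P r, ∀ a' ∈ above P r, a ≠ a' → a ∪ a' = U) : 3 ≤ newLabels P r := by
  set F := insert r (P.sup id) with hF
  have hP : ∀ a ∈ P, a ⊆ F := subset_insert_sup P r
  have hr : r ∈ F := mem_insert_self _ _
  rw [← newLabels_image_compl hP hr]
  refine three_le_newLabels_of_two_sunflower_three (K := F \ U) (isAntichain_image_compl hanti hP) ?_ ?_ ?_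
  · rw [card_above_image_compl hP hr, h2]
  · rw [card_below_image_compl hP hr, h3]
  · intro x hx y hy hxy
    rw [below_image_compl (P := P) hr] at hx hy
    obtain ⟨b, hb, rfl⟩ := mem_image.1 hx
    obtain ⟨b', hb', rfl⟩ := mem_image.1 hy
    have hbb' : b ≠ b' := by rintro rfl; exact hxy rfl
    rw [← sdiff_union_distrib, hU b hb b' hb' hbb']

end Summit.CriticalPhenomena.PercolationContinuityZ3.Theorems.SahiColouredDaykin
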